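import Summits.Ventures.PercRepro.RankLevelSetCircuitCount

/-!
# PercRepro — THE PARALLEL-PAIR COUNT AT BOUNDED NULLITY: `#(2-circuits) ≤ 2ν` when rank-`1` sets have `≤ 4` points
(p2, gen 14; SUBCLAIM-S1 Lemma T4, step (ii))

A `2`-element circuit is a pair of parallel non-loops. If every set of rank `≤ 1` has at most `4` points (so every
parallel class has `≤ 4` elements), the `2`-circuits number at most `2ν`, `ν = |E| − r(E)`: a class of `c` elements
carries `C(c, 2) ≤ 2(c − 1)` pairs and contributes `c − 1` to the nullity. Proof by induction on `|E|`: pick a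
`2`-circuit `{a, b}`, let `P = cl {a}` (`|P| ≤ 4`) and delete `D = P ∖ {a}`; the rank is unchanged (`D ⊆ cl {a}`),
the nullity drops by `|D|`, the `2`-circuits meeting `D` are `2`-subsets of `P` (`≤ C(|D| + 1, 2) ≤ 2|D|`), and the
others are the `2`-circuits of `M ＼ D`.

* **`ncard_two_circuits_le_two_mul`** — the count.
Axioms: standard.
-/

open scoped Matroid

namespace PercRepro

namespace S1

open Set

variable {α : Type}

/-- `r(M ＼ D) = r(M)` when `D ⊆ cl {a}` for some `a ∈ E ∖ D`. -/
theorem eRank_delete_eq_of_subset_closure (K : Matroid α) {a : α} {D : Set α} (ha : a ∈ K.E) (haD : a ∉ D)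
    (hD : D ⊆ K.closure {a}) : (K ＼ D).eRank = K.eRank := by
  rw [Matroid.eRank_def, Matroid.eRank_def, Matroid.delete_ground, Matroid.delete_eq_restrict,
    Matroid.restrict_eRk_eq _ (subset_refl _)]
  apply le_antisymm (K.eRk_mono sdiff_subset)
  have hsub : K.E ⊆ K.closure (K.E \ D) := by
    intro x hx
    by_cases hxD : x ∈ D
    · have h1 : K.closure {a} ⊆ K.closure (K.E \ D) :=
        K.closure_subset_closure (singleton_subset_iff.2 ⟨ha, haD⟩)
      exact h1 (hD hxD)
    · exact K.subset_closure (K.E \ D) sdiff_subset ⟨hx, hxD⟩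
  calc K.eRk K.E ≤ K.eRk (K.closure (K.E \ D)) := K.eRk_mono hsub
    _ = K.eRk (K.E \ D) := K.eRk_closure_eq _

/-- **The parallel-pair count.** If `|E| = r(E) + d` and every set of rank `≤ 1` has at most `4` points, then `M` has
at most `2d` circuits with `2` elements. -/
theorem ncard_two_circuits_le_two_mul (K : Matroid α) [K.Finite]
    (h1 : ∀ L ⊆ K.E, K.eRk L ≤ 1 → L.ncard ≤ 4) {d : ℕ} (hd : K.E.encard = K.eRank + d) :
    {C : Set α | K.IsCircuit C ∧ C.ncard = 2}.ncard ≤ 2 * d := by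
  suffices H : ∀ n : ℕ, ∀ (K : Matroid α) [K.Finite], K.E.ncard = n →
      (∀ L ⊆ K.E, K.eRk L ≤ 1 → L.ncard ≤ 4) → ∀ d : ℕ, K.E.encard = K.eRank + d →
      {C : Set α | K.IsCircuit C ∧ C.ncard = 2}.ncard ≤ 2 * d from H _ K rfl h1 d hd
  intro n
  induction n using Nat.strong_induction_on with
  | _ n ih =>
  intro K _ hn h1 d hd
  classical
  set S := {C : Set α | K.IsCircuit C ∧ C.ncard = 2} with hS
  have hSfin : S.Finite :=
    K.ground_finite.finite_subsets.subset (fun C hC => hC.1.subset_ground)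
  by_cases hSe : S = ∅
  · rw [hSe, ncard_empty]; exact Nat.zero_le _
  obtain ⟨C₀, hC₀⟩ := nonempty_iff_ne_empty.2 hSe
  obtain ⟨a, b, hab, hC₀ab⟩ := ncard_eq_two.1 hC₀.2
  have haC₀ : a ∈ C₀ := by rw [hC₀ab]; exact mem_insert a {b}
  have hbC₀ : b ∈ C₀ := by rw [hC₀ab]; exact mem_insert_of_mem a rfl
  have haE : a ∈ K.E := hC₀.1.subset_ground haC₀
  -- `a` is not a loop
  have hanl : K.IsNonloop a := by
    refine Matroid.isNonloop_of_not_isLoop haE ?_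
    intro hloop
    have h := hloop.eq_of_isCircuit_mem hC₀.1 haC₀
    have h2 := hC₀.2
    rw [h, ncard_singleton] at h2
    omega
  -- the rank as a natural number
  have hrfin : K.eRank ≠ ⊤ := PercRepro.Matroid.eRank_ne_top_of_finite K
  obtain ⟨r, hr⟩ := ENat.ne_top_iff_exists.1 hrfin
  have hEn : K.E.ncard = r + d := by
    have h := hd
    rw [← hr, ← K.ground_finite.cast_ncard_eq] at h
    exact_mod_cast h
  -- the parallel class `P = cl {a}` and `D = P ∖ {a}`
  set P := K.closure {a} with hP
  have hPE : P ⊆ K.E := K.closure_subset_ground _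
  have hPfin : P.Finite := K.ground_finite.subset hPE
  have haP : a ∈ P := K.mem_closure_self a haE
  have hPr : K.eRk P ≤ 1 := by
    rw [hP, K.eRk_closure_eq, hanl.eRk_eq]
  have hPcard : P.ncard ≤ 4 := h1 P hPE hPr
  set D := P \ {a} with hD
  have hDP : D ⊆ P := sdiff_subset
  have haD : a ∉ D := fun h => h.2 rfl
  have hDE : D ⊆ K.E := hDP.trans hPE
  have hDfin : D.Finite := hPfin.subset hDP
  have hbP : b ∈ P := by
    have h := hC₀.1.mem_closure_sdiff_singleton_of_mem hbC₀
    have h2 : C₀ \ {b} = {a} := by rw [hC₀ab, pair_sdiff_right hab]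
    rw [h2] at h
    exact h
  have hbD : b ∈ D := ⟨hbP, fun h => hab (mem_singleton_iff.1 h).symm⟩
  have hDne : D.Nonempty := ⟨b, hbD⟩
  set m := D.ncard with hm
  have hm1 : 1 ≤ m := by
    rw [hm]; exact Nat.one_le_iff_ne_zero.2 (by rw [Ne, ncard_eq_zero hDfin]; exact hDne.ne_empty)
  have hPm : P.ncard = m + 1 := by
    rw [hm, hD, ncard_sdiff_singleton_add_one haP hPfin]
  have hm3 : m ≤ 3 := by omega
  -- the deleted matroid
  set K' := K ＼ D with hK'
  have hK'rank : K'.eRank = K.eRank := eRank_delete_eq_of_subset_closure K haE haD hDP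
  have hK'E : K'.E = K.E \ D := Matroid.delete_ground K D
  have hK'card : K'.E.ncard + m = K.E.ncard := by
    rw [hK'E, hm]
    have h := encard_sdiff_add_encard_of_subset hDE
    rw [← (K.ground_finite.subset sdiff_subset).cast_ncard_eq, ← hDfin.cast_ncard_eq,
      ← K.ground_finite.cast_ncard_eq] at h
    exact_mod_cast h
  have hK'lt : K'.E.ncard < n := by rw [← hn]; omega
  have hmd : m ≤ d := by
    -- `r ≤ |E'|` since the rank of `K'` is at most the size of its ground set
    have h := K'.eRk_le_encard K'.E
    rw [← Matroid.eRank_def, hK'rank, ← hr, ← (K.ground_finite.subset (hK'E ▸ sdiff_subset)).cast_ncard_eq] at h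
    have h' : r ≤ K'.E.ncard := by exact_mod_cast h
    omega
  have hd' : K'.E.encard = K'.eRank + ((d - m : ℕ) : ℕ∞) := by
    rw [hK'rank, ← hr, ← (K.ground_finite.subset (hK'E ▸ sdiff_subset)).cast_ncard_eq]
    have : K'.E.ncard = r + (d - m) := by omega
    rw [this]; push_cast; rfl
  have h1' : ∀ L ⊆ K'.E, K'.eRk L ≤ 1 → L.ncard ≤ 4 := by
    intro L hL hr
    rw [hK'E] at hL
    rw [hK', Matroid.delete_eq_restrict, Matroid.restrict_eRk_eq _ hL] at hr
    exact h1 L (hL.trans sdiff_subset) hr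
  -- split the `2`-circuits by whether they meet `D`
  set S₁ := {C : Set α | C ⊆ P ∧ C.ncard = 2} with hS₁
  set S₂ := {C : Set α | K'.IsCircuit C ∧ C.ncard = 2} with hS₂
  have hsplit : S ⊆ S₁ ∪ S₂ := by
    intro C hC
    by_cases hCD : Disjoint C D
    · exact Or.inr ⟨Matroid.delete_isCircuit_iff.2 ⟨hC.1, hCD⟩, hC.2⟩
    · left
      refine ⟨?_, hC.2⟩
      obtain ⟨u, huC, huD⟩ := not_disjoint_iff.1 hCD
      have huP : u ∈ P := hDP huD
      have hCfin : C.Finite := K.ground_finite.subset hC.1.subset_ground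
      have hunl : K.IsNonloop u := by
        refine Matroid.isNonloop_of_not_isLoop (hC.1.subset_ground huC) ?_
        intro hloop
        have h := hloop.eq_of_isCircuit_mem hC.1 huC
        have h2 := hC.2
        rw [h, ncard_singleton] at h2
        omega
      have hcl : K.closure {u} = K.closure {a} := hunl.closure_eq_of_mem_closure huP
      intro v hvC
      by_cases hvu : v = u
      · rw [hvu]; exact huP
      · have hv : v ∈ K.closure (C \ {v}) := hC.1.mem_closure_sdiff_singleton_of_mem hvC
        have hCuv : ({u, v} : Set α) ⊆ C := insert_subset_iff.2 ⟨huC, singleton_subset_iff.2 hvC⟩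
        have hCeq : C = {u, v} :=
          (eq_of_subset_of_ncard_le hCuv (by rw [hC.2, ncard_pair (Ne.symm hvu)]) hCfin).symm
        have hCv : C \ {v} = {u} := by rw [hCeq, pair_sdiff_right (Ne.symm hvu)]
        rw [hCv, hcl] at hv
        exact hv
  have hS₁fin : S₁.Finite := hPfin.finite_subsets.subset (fun C hC => hC.1)
  have hS₂fin : S₂.Finite := K'.ground_finite.finite_subsets.subset (fun C hC => hC.1.subset_ground)
  -- the `2`-subsets of `P` number `C(|P|, 2)`
  have hS₁card : S₁.ncard ≤ (m + 1).choose 2 := by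
    have hsub : S₁ ⊆ ((hPfin.toFinset.powersetCard 2).image (fun t : Finset α => (t : Set α)) : Set (Set α)) := by
      intro C hC
      have hCfin : C.Finite := hPfin.subset hC.1
      rw [Finset.coe_image]
      refine ⟨hCfin.toFinset, ?_, by simp⟩
      rw [Finset.mem_coe, Finset.mem_powersetCard]
      refine ⟨?_, ?_⟩
      · intro x hx
        rw [Finite.mem_toFinset] at hx ⊢
        exact hC.1 hx
      · rw [← ncard_eq_toFinset_card C hCfin]; exact hC.2
    calc S₁.ncard ≤ ((hPfin.toFinset.powersetCard 2).image (fun t : Finset α => (t : Set α)) : Set (Set α)).ncard :=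
          ncard_le_ncard hsub (Finset.finite_toSet _)
      _ = ((hPfin.toFinset.powersetCard 2).image (fun t : Finset α => (t : Set α))).card := ncard_coe_finset _
      _ ≤ (hPfin.toFinset.powersetCard 2).card := Finset.card_image_le
      _ = (m + 1).choose 2 := by
          rw [Finset.card_powersetCard, ← hPm, ncard_eq_toFinset_card P hPfin]
  have hS₂card : S₂.ncard ≤ 2 * (d - m) := ih _ hK'lt K' rfl h1' (d - m) hd'
  have hchoose : (m + 1).choose 2 ≤ 2 * m := by
    interval_cases m <;> decide
  calc S.ncard ≤ (S₁ ∪ S₂).ncard := ncard_le_ncard hsplit (hS₁fin.union hS₂fin)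
    _ ≤ S₁.ncard + S₂.ncard := ncard_union_le _ _
    _ ≤ (m + 1).choose 2 + 2 * (d - m) := add_le_add hS₁card hS₂card
    _ ≤ 2 * m + 2 * (d - m) := by omega
    _ = 2 * d := by omega

end S1

end PercRepro
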